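import Mathlib.RingTheory.AdicCompletion.Basic
import Mathlib.RingTheory.PowerSeries.Basic
import HarnessLib

/-!
# `S⟦X⟧` is `(p)`-adically complete when `S` is: `IsAdicComplete (p) S ⟹ IsAdicComplete (C p) S⟦X⟧` (coefficientwise)
# (Washington §7.1: `Λ = ℤ_p⟦T⟧` is complete for the `(p, T)`-, hence `p`-adic topology; de Shalit I §3.1)

Washington, *Introduction to Cyclotomic Fields* (1997), §7.1: `𝒪⟦T⟧` is a complete local ring; in particular `p`-adic Cauchy
sequences of power series converge coefficientwise.  For the two-variable Λ-modules of de Shalit I §3 (the coordinate module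
`𝒪⟦X⟧⟦Y⟧ = S⟦Y⟧` over `S = 𝒪⟦X⟧`) the tree's `(p, Y)`-adic limit machinery (`LubinTate.adicFiltGen`, `tAct`,
`PowerSeriesTopNilpotentBasis(Free)`) asks for `IsAdicComplete (Ideal.span {p}) S` of the COEFFICIENT ring; this file supplies it for
`S = R⟦X⟧`, `p = C p₀`:

* `mem_span_C_iff` — `x ∈ (C a) ↔` every coefficient of `x` lies in `(a)`; `mem_span_C_pow_smul_top_iff`;
* ★ `isHausdorff_span_C`, ★ `isPrecomplete_span_C`, ★★ `isAdicComplete_span_C` —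
  **`R⟦X⟧` is `(C p₀)`-adically Hausdorff / precomplete / complete when `R` is `(p₀)`-adically so** (coefficientwise limits).

Everything PROVED (0 sorry, no named facts, no definitions).

## References

* L. C. Washington, *Introduction to Cyclotomic Fields*, 2nd ed. (1997), §7.1. [Washington1997]
* E. de Shalit, *Iwasawa theory of elliptic curves with complex multiplication* (1987), Ch. I §3.1. [deShalit1987]
-/

noncomputable section

namespace Literature.NumberTheory.GaloisRepresentations

namespace LubinTate

section CoeffAdicComplete

open PowerSeries

variable {R : Type*} [CommRing R]

/-- `x ∈ (C a) ↔ ∀ i, [X^i]x ∈ (a)` (choose the quotients coefficientwise). [cite: Washington1997, §7.1] -/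
theorem mem_span_C_iff {a : R} {x : PowerSeries R} : x ∈ Ideal.span {C a} ↔ ∀ i, coeff i x ∈ Ideal.span {a} := by
  constructor
  · intro h i
    obtain ⟨y, hy⟩ := Ideal.mem_span_singleton'.mp h
    rw [← hy, mul_comm, coeff_C_mul]
    exact Ideal.mem_span_singleton'.mpr ⟨coeff i y, mul_comm _ _⟩
  · intro h
    have hy : ∀ i, ∃ y : R, coeff i x = a * y := fun i => by
      obtain ⟨y, hy⟩ := Ideal.mem_span_singleton'.mp (h i)
      exact ⟨y, by rw [← hy, mul_comm]⟩
    choose y hy using hy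
    refine Ideal.mem_span_singleton'.mpr ⟨mk y, ?_⟩
    ext i
    rw [mul_comm, coeff_C_mul, coeff_mk, hy i]

/-- `x ∈ (C a)^n • ⊤ ↔ ∀ i, [X^i]x ∈ (a^n)`. [cite: Washington1997, §7.1] -/
theorem mem_span_C_pow_smul_top_iff {a : R} {n : ℕ} {x : PowerSeries R} :
    x ∈ (Ideal.span {C a} ^ n • ⊤ : Submodule (PowerSeries R) (PowerSeries R)) ↔ ∀ i, coeff i x ∈ Ideal.span {a ^ n} := by
  rw [smul_eq_mul, Ideal.mul_top, Ideal.span_singleton_pow, ← map_pow, mem_span_C_iff]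

/-- The same for the coefficient ring: `y ∈ (a)^n • ⊤ ↔ y ∈ (a^n)` (cf. `LubinTateFrobeniusTwist.mem_span_pow_smul_top_iff`). [folklore] -/
private theorem mem_span_pow_smul_top_iff_mem {a : R} {n : ℕ} {y : R} :
    y ∈ (Ideal.span {a} ^ n • ⊤ : Submodule R R) ↔ y ∈ Ideal.span {a ^ n} := by
  rw [smul_eq_mul, Ideal.mul_top, Ideal.span_singleton_pow]

/-- ★ **`R⟦X⟧` is `(C a)`-adically Hausdorff when `R` is `(a)`-adically Hausdorff.** [cite: Washington1997, §7.1] -/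
theorem isHausdorff_span_C {a : R} [IsHausdorff (Ideal.span {a}) R] : IsHausdorff (Ideal.span {C a}) (PowerSeries R) := by
  refine ⟨fun x hx => ?_⟩
  ext i
  rw [map_zero]
  refine IsHausdorff.haus' (I := Ideal.span {a}) _ fun n => ?_
  rw [SModEq.sub_mem, sub_zero, mem_span_pow_smul_top_iff_mem]
  have h := hx n
  rw [SModEq.sub_mem, sub_zero, mem_span_C_pow_smul_top_iff] at h
  exact h i

/-- ★ **`R⟦X⟧` is `(C a)`-adically precomplete when `R` is `(a)`-adically precomplete** (coefficientwise limits).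
[cite: Washington1997, §7.1] -/
theorem isPrecomplete_span_C {a : R} [IsPrecomplete (Ideal.span {a}) R] : IsPrecomplete (Ideal.span {C a}) (PowerSeries R) := by
  refine ⟨fun {f} hf => ?_⟩
  have hcoef : ∀ i, ∃ L : R, ∀ n, coeff i (f n) ≡ L [SMOD (Ideal.span {a} ^ n • ⊤ : Submodule R R)] := by
    intro i
    refine IsPrecomplete.prec' (fun n => coeff i (f n)) fun {m n} hmn => ?_
    rw [SModEq.sub_mem, mem_span_pow_smul_top_iff_mem, ← map_sub]
    have h := hf hmn
    rw [SModEq.sub_mem, mem_span_C_pow_smul_top_iff] at h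
    exact h i
  choose L hL using hcoef
  refine ⟨mk L, fun n => ?_⟩
  rw [SModEq.sub_mem, mem_span_C_pow_smul_top_iff]
  intro i
  rw [map_sub, coeff_mk]
  have h := hL i n
  rwa [SModEq.sub_mem, mem_span_pow_smul_top_iff_mem] at h

/-- ★★ **`R⟦X⟧` is `(C a)`-adically complete when `R` is `(a)`-adically complete** — e.g. `S = 𝒪⟦X⟧`, `a = π`: the coefficient ring of
the two-variable coordinate module `𝒪⟦X⟧⟦Y⟧`. [cite: Washington1997, §7.1] -/
theorem isAdicComplete_span_C {a : R} [IsAdicComplete (Ideal.span {a}) R] : IsAdicComplete (Ideal.span {C a}) (PowerSeries R) :=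
  { isHausdorff_span_C, isPrecomplete_span_C with }

end CoeffAdicComplete

end LubinTate

end Literature.NumberTheory.GaloisRepresentations
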